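import Summits.Schanuel.Schanuel.Theses.RigidCore
import Literature.Barriers.Schanuel.LargeTranscendenceDegreeHolds
import Literature.NumberTheory.Transcendental.SchanuelSectorSplit
import Literature.NumberTheory.Transcendental.LindemannWeierstrassProofs

/-!
# Line `kernel-tower-relative-lw` — skeleton for crux `RigidCore.SchanuelOnLogFreeCore`
# (stmt-Schanuel-0970, route-Schanuel-RigidCore, rank 4)

**Crux (fixed, by name).** `SchanuelOnLogFreeCore`: Schanuel's conjecture for `ℚ`-linearly
independent tuples from the log-free core
`C_EA = sInf {K ≤ ℂ | 2πi ∈ K, K exp-closed, K relatively algebraically closed}`.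

**Idea (card `Ideas/kernel-tower-relative-lw.md`, triage r1: pass/fail/pass).** Read Kirby's
e/a-chain INSIDE `ℂ` at `F = ℚ(2πi)`: `L₀ = \overline{ℚ(2πi)} ∩ ℂ`,
`L_{m+1} = \overline{L_m(e^{L_m})} ∩ ℂ` (`tower`). Because the core is LOG-FREE every step is a
purely exponential extension of a relatively algebraically closed field, so the crux is reached
from two RELATIVE LINDEMANN–WEIERSTRASS layers in which the kernel is consumed exactly once, at
level `0`:
* `stub_relLWZero`  (`RelLW₀`): `u ⊂ L₀` independent mod `ℚ·2πi` ⇒ `e^u` alg. independent / `L₀`;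
* `stub_relLWStep`  (`RelLW_{m+1}`): `u ⊂ L_{m+1}` independent mod `L_m` ⇒ `e^u` alg. indep. / `L_{m+1}`;
* `stub_coreExhaustion`: `C_EA ⊆ ⋃ₘ L_m` (definition audit of the inlined `sInf`, provable now);
* `stub_piPowersTH`: the Technical Hypothesis for `(1, 2πi, …, (2πi)^{d-1})` (provable from a
  transcendence measure of `π`; level-0 CALIBRATION only, feeding `hankelQuarter`, not `_of`).

**Shape.** `SchanuelOnLogFreeCore_of : RigidCore.SchanuelOnLogFreeCore` concludes the crux BY
NAME with no hypotheses; `sorry` occurs only in the four `stub_*`; everything else is proved here: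
the generic SECTOR SPLIT at a `ℚ`-subspace (`sectorSplit`, Kirby's `GL_n(ℚ)` bookkeeping of the
tree's `schanuel_of_sector_split_set`, re-cut so that its "outside" input is an algebraic
independence over the big field — the relative-LW shape), the base split at the kernel line
(`insideKernelLine`: `trdeg ℚ(q·2πi, e^{q·2πi}) = 1`, Lindemann), the induction up the tower
(`schanuelOn_tower`), the reduction (`towerReduction`), the certificate that Stub 1 at
`r = 1, u = (1)` is `e ⊥ π` (`expOnePi_of_relLWZero : RelLW₀ → ExpOnePiAlgebraicIndependent`,
hypothetical, closes nothing), and Diaz's Theorem 2.7 on the kernel grid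
(`hankelBound`/`hankelQuarter`: `⌈d/2⌉ ≤ trdeg ℚ(π, e, e^{τ²}, …, e^{τ^{2d-2}})`, `d ≥ 3`, from the
PROVED `LargeTranscendenceDegree_holds`, modulo Stub 4).

**Disproof used** (cdisprove `Disproof.lean` on stmt-Schanuel-0970, cycles 1/1b, 2026-08-15 — read
through its evidence notes; the file itself is not mounted in this seat and no `Negative/` lemma
has landed, so nothing to import): `¬WithoutLinIndep*` (H = `LinearIndependent ℚ x` is
load-bearing) — honoured: H is consumed in `sectorSplit` (`finrank_span_eq_card hx` gives
`k + m = n`) and in both RelLW stubs as independence modulo the previous level; `WithoutCore ↔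
Schanuel` (H = core membership) — honoured: consumed once, by `stub_coreExhaustion` in
`towerReduction`; tightness `trdeg = 1 at x = (2πi)` — matched exactly by `insideKernelLine`;
refuted strengthenings (`n+1 ≤ trdeg`, `2n ≤`, `AlgIndep x`, `AlgIndep e^x at (1, πi)`) — no stub
asserts any of them: the RelLW layers assert independence of `e^u` only for `u` independent MODULO
`ℚ·2πi` resp. `L_m` (so `(1, πi)` is not an instance: `πi ∈ ℚ·τ`), and over the level field, which
is what the exact normal form requires; `rank_two_through_pi` / `expOnePiAlgebraicIndependent_of_crux`
— acknowledged: `expOnePi_of_relLWZero` shows Stub 1 inherits `e ⊥ π` at its first instance;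
`eDerivation_apply_eq_zero_of_mem_core` (barrier `AxSchanuelFunctionalNotNumerical`) — respected:
no stub is a derivation/Ax statement. Negatives index (`ledger negatives --problem Schanuel`:
PolarPhantoms ×2): no stub instantiates either.
-/

noncomputable section

open IntermediateField Complex

namespace Summit.Schanuel.Schanuel.Cruxes.SchanuelOnLogFreeCore.KernelTowerRelativeLw

/-! ## The objects of the line -/

/-- The kernel generator `τ = 2πi` (spelled exactly as in the route term). -/
abbrev τ : ℂ := 2 * (Real.pi : ℂ) * Complex.I

/-- The log-free core `C_EA`: VERBATIM the `sInf` inlined in the route decl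
`RigidCore.SchanuelOnLogFreeCore` (smallest relatively algebraically closed, `exp`-closed subfield
of `ℂ` containing `2πi`). -/
def logFreeCore : IntermediateField ℚ ℂ :=
  sInf {K : IntermediateField ℚ ℂ | (2 * ↑Real.pi * Complex.I : ℂ) ∈ K ∧
    (∀ w ∈ K, Complex.exp w ∈ K) ∧ ∀ w : ℂ, IsAlgebraic K w → w ∈ K}

/-- Relative algebraic closure of an intermediate field `K` inside `ℂ` (Mathlib's
`algebraicClosure K ℂ`, scalars restricted to `ℚ`). -/
def relAlgClosure (K : IntermediateField ℚ ℂ) : IntermediateField ℚ ℂ :=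
  (algebraicClosure (↥K) ℂ).restrictScalars ℚ

/-- **The kernel tower** (Kirby, *Finitely presented exponential fields*, arXiv:0912.4019,
Construction 2.9, read inside `ℂ` at `F = ℚ(2πi)`): `L₀ = \overline{ℚ(2πi)} ∩ ℂ`,
`L_{m+1} = \overline{L_m(e^{L_m})} ∩ ℂ` (relative algebraic closures in `ℂ`). -/
def tower : ℕ → IntermediateField ℚ ℂ
  | 0 => relAlgClosure (adjoin ℚ {τ})
  | m + 1 => relAlgClosure (adjoin ℚ ((tower m : Set ℂ) ∪ Complex.exp '' (tower m : Set ℂ)))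

/-- Sanity: the crux is Schanuel's statement for tuples from `logFreeCore` (definitional). -/
example : (∀ (n : ℕ) (x : Fin n → ℂ), (∀ i, x i ∈ logFreeCore) → LinearIndependent ℚ x →
    (n : Cardinal) ≤ Algebra.trdeg ℚ ↥(adjoin ℚ (Set.range x ∪ Set.range (Complex.exp ∘ x)))) ↔
    Summit.Schanuel.Schanuel.Theses.RigidCore.SchanuelOnLogFreeCore := Iff.rfl

/-- Powers `1, τ, …, τ^{d-1}` of the kernel generator (the canonical symmetric grid of `L₀`). -/
def τpow (d : ℕ) : Fin d → ℂ := fun i => τ ^ (i : ℕ)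

/-! ## The four registered stubs -/

/-- **Stub 1 — `RelLW₀`, relative Lindemann–Weierstrass over `L₀ = \overline{ℚ(π)}` modulo the
kernel** (OPEN; the honest residue of the crux at level 0): exponentials of elements of `L₀` that
are `ℚ`-linearly independent modulo `ℚ·2πi` are algebraically independent over `L₀`.
Instances: `r = 1, u = (1)` is `e ⊥ π` (`ExpOnePiAlgebraicIndependent`, open — certified below by
`expOnePi_of_relLWZero`); `u = (π²)` contains `e^{π²} ∉ ℚ̄` (open); `u = (i)`: `π ⊥ e^{i}` (open);
`u = (π√d)`, `d ∈ ℕ` not a square: `e^{π√d}` transcendental over `\overline{ℚ(π)}` = Nesterenko 1996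
(PROVED, `nesterenko1996_thm_1_1_holds`); `u = (log α)`, `α ∈ ℚ̄`: the stub forces `log α ∉ L₀`,
i.e. `π ⊥ log α` (Baker-strength face, barrier `AlgebraicIndependenceOfLogarithms`); the Hankel
family `u = (τ², …, τ^{2d-2})` (a quarter certified: `hankelQuarter`). TRUE under Schanuel's
conjecture (predimension count on the chain tuple `(τ, u)`; triage r1-1/r1-2/r1-3). -/
theorem stub_relLWZero :
    ∀ (r : ℕ) (u : Fin r → ℂ), (∀ i, u i ∈ tower 0) →
      LinearIndependent ℚ ((Submodule.span ℚ ({τ} : Set ℂ)).mkQ ∘ u) →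
        AlgebraicIndependent (↥(tower 0)) (fun i => Complex.exp (u i)) := by
  sorry

/-- **Stub 2 — `RelLW_{m+1}`, heredity up the tower** (OPEN): exponentials of elements of
`L_{m+1}` that are `ℚ`-linearly independent modulo `L_m` are algebraically independent over
`L_{m+1}` ("`exp` of a point of `L_{m+1}` generic over `L_m` stays generic"). First instance above
Lindemann–Weierstrass: `m = 0, u = (e)`: `e^e` is transcendental over `L₁ ∋ π, e, e^{π²}, …`.
TRUE under Schanuel's conjecture (same count). -/
theorem stub_relLWStep :
    ∀ (m r : ℕ) (u : Fin r → ℂ), (∀ i, u i ∈ tower (m + 1)) →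
      LinearIndependent ℚ ((Submodule.span ℚ (tower m : Set ℂ)).mkQ ∘ u) →
        AlgebraicIndependent (↥(tower (m + 1))) (fun i => Complex.exp (u i)) := by
  sorry

/-- **Stub 3 — exhaustion of the core by the tower** (PROVABLE NOW, bookkeeping ~150 lines):
every element of `C_EA` lies in some level `L_m`. Proof route: `⋃ₘ L_m` is (the carrier of) the
intermediate field `⨆ₘ L_m` (`IntermediateField.coe_iSup_of_directed`, the tower is monotone:
`tower_mono` below); it contains `2πi` (`τ_mem_tower`), is `exp`-closed (`exp_mem_tower_succ`) and
relatively algebraically closed (a `w` algebraic over `⋃ L_m` is algebraic over some `L_M`, finitely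
many coefficients, hence lies in `L_M = relAlgClosure _`, `algebraicClosure.algebraicClosure_eq_bot`);
so it belongs to the `sInf` family and `logFreeCore ≤ ⨆ₘ L_m` (`sInf_le`). -/
theorem stub_coreExhaustion : ∀ a : ℂ, a ∈ logFreeCore → ∃ m : ℕ, a ∈ tower m := by
  sorry

/-- **Stub 4 — the Technical Hypothesis for the powers of `2πi`** (PROVABLE from a transcendence
MEASURE for `π`, to be vendored as a named fact: `|P(π)| ≥ H^{-c(d)}` for `P ∈ ℤ[X]∖0`,
`deg P ≤ d`, height `≤ H`, `H ≥ H₀(d)` — Mahler 1953 / Fel'dman 1960, Waldschmidt LNM 402 §4;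
then split `Q(2πi) = A(π²)·1 + B(π²)·2πi`-style into real and imaginary parts and apply
`Literature.NumberTheory.Transcendental.TechnicalHypothesis.of_lowerBound`, exactly as the tree's
`technicalHypothesis_pow` does for algebraic `β` with Liouville). Level-0 calibration stub: it is
NOT on the path to `SchanuelOnLogFreeCore_of`; it makes Diaz's Theorem 2.7 unconditional on the
kernel grid (`hankelQuarter` below). -/
theorem stub_piPowersTH :
    ∀ d : ℕ, Literature.Barriers.Schanuel.TechnicalHypothesis (τpow d) := by
  sorry

/-! ## Glue, part 1: the tower -/

theorem mem_relAlgClosure_iff {K : IntermediateField ℚ ℂ} {a : ℂ} :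
    a ∈ relAlgClosure K ↔ IsAlgebraic (↥K) a := by
  simp [relAlgClosure, IntermediateField.mem_restrictScalars, mem_algebraicClosure_iff]

theorem le_relAlgClosure (K : IntermediateField ℚ ℂ) : K ≤ relAlgClosure K := fun a ha =>
  mem_relAlgClosure_iff.mpr (isAlgebraic_algebraMap (⟨a, ha⟩ : ↥K))

theorem mem_relAlgClosure_of_isAlgebraic (K : IntermediateField ℚ ℂ) {a : ℂ}
    (ha : IsAlgebraic ℚ a) : a ∈ relAlgClosure K :=
  mem_relAlgClosure_iff.mpr (IsAlgebraic.tower_top (L := ↥K) ha)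

/-- Each level is relatively algebraically closed in `ℂ`. -/
theorem mem_relAlgClosure_of_isAlgebraic_relAlgClosure (K : IntermediateField ℚ ℂ) {a : ℂ}
    (ha : IsAlgebraic (↥(relAlgClosure K)) a) : a ∈ relAlgClosure K := by
  rw [mem_relAlgClosure_iff]
  have ha' : IsAlgebraic (↥(algebraicClosure (↥K) ℂ)) a := ha
  exact ha'.restrictScalars (↥K)

theorem tower_zero : tower 0 = relAlgClosure (adjoin ℚ {τ}) := rfl

theorem tower_succ (m : ℕ) :
    tower (m + 1) = relAlgClosure (adjoin ℚ ((tower m : Set ℂ) ∪ Complex.exp '' (tower m : Set ℂ))) :=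
  rfl

theorem τ_mem_tower_zero : τ ∈ tower 0 :=
  le_relAlgClosure _ (subset_adjoin ℚ _ (Set.mem_singleton τ))

theorem tower_le_succ (m : ℕ) : tower m ≤ tower (m + 1) := fun _ ha =>
  le_relAlgClosure _ (subset_adjoin ℚ _ (Or.inl ha))

theorem tower_mono : Monotone tower := monotone_nat_of_le_succ tower_le_succ

theorem exp_mem_tower_succ {m : ℕ} {a : ℂ} (ha : a ∈ tower m) : Complex.exp a ∈ tower (m + 1) :=
  le_relAlgClosure _ (subset_adjoin ℚ _ (Or.inr ⟨a, ha, rfl⟩))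

theorem τ_mem_tower (m : ℕ) : τ ∈ tower m := tower_mono (Nat.zero_le m) τ_mem_tower_zero

/-- Elements of the `ℚ`-span of a subset of an intermediate field lie in the field. -/
theorem mem_of_mem_span {L : IntermediateField ℚ ℂ} {T : Set ℂ} (hT : T ⊆ L) {a : ℂ}
    (ha : a ∈ Submodule.span ℚ T) : a ∈ L := by
  induction ha using Submodule.span_induction with
  | mem b hb => exact hT hb
  | zero => exact zero_mem L
  | add b c _ _ hb hc => exact add_mem hb hc
  | smul q b _ hb => exact L.smul_mem hb

/-- `2πi` is transcendental (Lindemann: `transcendental_pi_holds`). -/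
theorem transcendental_τ : Transcendental ℚ τ := by
  intro h
  have hI : IsAlgebraic ℚ Complex.I := by
    refine ⟨Polynomial.X ^ 2 + 1, Polynomial.Monic.ne_zero (by monicity!), ?_⟩
    simp
  have h2 : IsAlgebraic ℚ ((-2 : ℤ) : ℂ)⁻¹ := (isAlgebraic_int (-2)).inv
  have hpi : IsAlgebraic ℚ (Real.pi : ℂ) := by
    have e : (Real.pi : ℂ) = 2 * Real.pi * I * I * ((-2 : ℤ) : ℂ)⁻¹ := by
      rw [mul_assoc (2 * (Real.pi : ℂ)), Complex.I_mul_I]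
      push_cast
      ring
    rw [e]
    exact (h.mul hI).mul h2
  exact Literature.NumberTheory.Transcendental.transcendental_pi_holds
    ((isAlgebraic_algebraMap_iff (A := ℂ) Complex.ofReal_injective).mp hpi)

theorem τ_ne_zero : τ ≠ 0 := fun h => transcendental_τ (h ▸ isAlgebraic_zero)

/-- `e^{a}` is algebraic for every `a ∈ ℚ·2πi` (a root of unity). -/
theorem isAlgebraic_exp_of_mem_span_τ {a : ℂ} (ha : a ∈ Submodule.span ℚ ({τ} : Set ℂ)) :
    IsAlgebraic ℚ (Complex.exp a) := by
  refine Literature.NumberTheory.Transcendental.isAlgebraic_exp_of_mem_span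
    (Submodule.span_mono ?_ ha)
  intro b hb
  rw [Set.mem_singleton_iff.mp hb]
  show IsAlgebraic ℚ (Complex.exp (2 * ↑Real.pi * Complex.I))
  rw [Complex.exp_two_pi_mul_I]
  exact isAlgebraic_one

/-- A transcendental element of an intermediate field forces positive transcendence degree. -/
theorem one_le_trdeg_of_transcendental_mem {L : IntermediateField ℚ ℂ} {w : ℂ} (hw : w ∈ L)
    (ht : Transcendental ℚ w) : (1 : Cardinal) ≤ Algebra.trdeg ℚ L := by
  haveI : Algebra.Transcendental ℚ L :=
    ⟨⟨⟨w, hw⟩, fun h => ht (IntermediateField.isAlgebraic_iff.mp h)⟩⟩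
  exact Cardinal.one_le_iff_pos.mpr (trdeg_pos ℚ L)

/-- **Inside the kernel line**: a `ℚ`-linearly independent tuple inside `ℚ·2πi` has length `≤ 1`
and `trdeg ℚ(q·2πi, e^{q·2πi}) = 1` (`π` transcendental). -/
theorem insideKernelLine :
    ∀ (k : ℕ) (y : Fin k → ℂ), (∀ i, y i ∈ Submodule.span ℚ ({τ} : Set ℂ)) →
      LinearIndependent ℚ y →
        (k : Cardinal) ≤ Algebra.trdeg ℚ ↥(adjoin ℚ (Set.range y ∪ Set.range (Complex.exp ∘ y))) := by
  intro k y hy hli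
  -- `k ≤ 1`
  set P : Submodule ℚ ℂ := Submodule.span ℚ ({τ} : Set ℂ) with hP
  let y' : Fin k → P := fun i => ⟨y i, hy i⟩
  have hli' : LinearIndependent ℚ y' := LinearIndependent.of_comp P.subtype (by exact hli)
  have hk : k ≤ 1 := by
    have h1 := hli'.fintype_card_le_finrank
    rw [Fintype.card_fin] at h1
    exact h1.trans ((finrank_span_le_card ({τ} : Set ℂ)).trans (by simp))
  interval_cases k
  · simp
  · have hy0 : y 0 ≠ 0 := hli.ne_zero 0
    have hyt : Transcendental ℚ (y 0) := by
      obtain ⟨c, hc⟩ := Submodule.mem_span_singleton.mp (hy 0)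
      intro halg
      have hc0 : c ≠ 0 := by rintro rfl; exact hy0 (by rw [← hc, zero_smul])
      apply transcendental_τ
      have : τ = c⁻¹ • y 0 := by rw [← hc, smul_smul, inv_mul_cancel₀ hc0, one_smul]
      rw [this, Rat.smul_def]
      exact (isAlgebraic_algebraMap (c⁻¹ : ℚ)).mul halg
    have hmem : y 0 ∈ adjoin ℚ (Set.range y ∪ Set.range (Complex.exp ∘ y)) :=
      subset_adjoin ℚ _ (Or.inl ⟨0, rfl⟩)
    simpa using one_le_trdeg_of_transcendental_mem hmem hyt

/-! ## Glue, part 2: the sector split at a `ℚ`-subspace (Kirby's `GL_n(ℚ)` bookkeeping) -/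

open Submodule in
/-- **Sector split** (the tree's `schanuel_of_sector_split_set` / Kirby 2010 Prop. 7.2
bookkeeping, in RELATIVE-LW form). Let `S ⊆ L` with `e^{span S} ⊆ L`. If (inside) Schanuel
holds for `ℚ`-linearly independent tuples from `span_ℚ S`, and (outside) exponentials of
tuples from `L` that are `ℚ`-linearly independent modulo `span_ℚ S` are algebraically
independent over `L`, then Schanuel holds for all `ℚ`-linearly independent tuples from `L`.
Proof: `V = span x̄`, `W = V ⊓ span S`, `U` a complement, bases `y` of `W`, `z` of `U` cleared of
denominators (so `y, z, e^y, e^z ∈ ℚ(x̄, e^{x̄})`); `k ≤ trdeg ℚ(y, e^y)` (inside);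
`e^z` algebraically independent over `L ⊇ ℚ(y, e^y, z)` (outside), so
`m ≤ trdeg_{ℚ(y,e^y,z)} ℚ(y, e^y, z)(e^z)`; the tower law gives `k + m = n ≤ trdeg ℚ(y, e^y, z, e^z)
≤ trdeg ℚ(x̄, e^{x̄})`. -/
theorem sectorSplit (S : Set ℂ) (L : IntermediateField ℚ ℂ) (hSL : S ⊆ L)
    (hexpS : ∀ a ∈ Submodule.span ℚ S, Complex.exp a ∈ L)
    (hIn : ∀ (k : ℕ) (y : Fin k → ℂ), (∀ i, y i ∈ Submodule.span ℚ S) → LinearIndependent ℚ y →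
      (k : Cardinal) ≤ Algebra.trdeg ℚ ↥(adjoin ℚ (Set.range y ∪ Set.range (Complex.exp ∘ y))))
    (hOut : ∀ (m : ℕ) (z : Fin m → ℂ), (∀ j, z j ∈ L) →
      LinearIndependent ℚ ((Submodule.span ℚ S).mkQ ∘ z) →
        AlgebraicIndependent (↥L) (fun j => Complex.exp (z j))) :
    ∀ (n : ℕ) (x : Fin n → ℂ), (∀ i, x i ∈ L) → LinearIndependent ℚ x →
      (n : Cardinal) ≤ Algebra.trdeg ℚ ↥(adjoin ℚ (Set.range x ∪ Set.range (Complex.exp ∘ x))) := by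
  intro n x hxL hx
  set Eq : Submodule ℚ ℂ := span ℚ S with hEqdef
  -- the `ℚ`-span `V` of `x̄`, `W = V ∩ E` and a complement `U` of `W` in `V`
  set V : Submodule ℚ ℂ := span ℚ (Set.range x) with hV
  haveI : FiniteDimensional ℚ V := FiniteDimensional.span_of_finite ℚ (Set.finite_range x)
  set W : Submodule ℚ ℂ := V ⊓ Eq with hW
  obtain ⟨U', hU'⟩ := W.exists_isCompl
  set U : Submodule ℚ ℂ := V ⊓ U' with hU
  haveI : FiniteDimensional ℚ W := Submodule.finiteDimensional_of_le inf_le_left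
  haveI : FiniteDimensional ℚ U := Submodule.finiteDimensional_of_le inf_le_left
  have hWU_sup : W ⊔ U = V := by
    rw [hU, inf_comm, ← sup_inf_assoc_of_le U' (inf_le_left : W ≤ V), hU'.sup_eq_top, top_inf_eq]
  have hWU_disj : Disjoint W U := hU'.disjoint.mono_right inf_le_right
  have hUE_disj : Disjoint U Eq := by
    rw [disjoint_def]
    intro a haU haE
    exact (disjoint_def.mp hWU_disj) a ⟨inf_le_left (b := U') haU, haE⟩ haU
  -- `V ⊆ L`
  have hVL : ∀ a ∈ V, a ∈ L := fun a ha =>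
    mem_of_mem_span (L := L) (T := Set.range x) (Set.range_subset_iff.mpr hxL) ha
  -- dimensions
  set k := Module.finrank ℚ W
  set m := Module.finrank ℚ U
  have hn : k + m = n := by
    have h1 := Submodule.finrank_sup_add_finrank_inf_eq W U
    rw [hWU_disj.eq_bot, finrank_bot, add_zero, hWU_sup] at h1
    rw [← h1, hV, finrank_span_eq_card hx, Fintype.card_fin]
  -- bases
  let bW := Module.finBasis ℚ W
  let bU := Module.finBasis ℚ U
  let y : Fin k → ℂ := fun i => (bW i : ℂ)
  let z : Fin m → ℂ := fun j => (bU j : ℂ)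
  have hy_mem : ∀ i, y i ∈ Eq := fun i => ((bW i).2 : (bW i : ℂ) ∈ V ⊓ Eq).2
  have hy_V : ∀ i, y i ∈ V := fun i => ((bW i).2 : (bW i : ℂ) ∈ V ⊓ Eq).1
  have hz_U : ∀ j, z j ∈ U := fun j => (bU j).2
  have hz_V : ∀ j, z j ∈ V := fun j => inf_le_left (b := U') (hz_U j)
  have hy_li : LinearIndependent ℚ y := bW.linearIndependent.map' W.subtype W.ker_subtype
  have hz_li : LinearIndependent ℚ z := bU.linearIndependent.map' U.subtype U.ker_subtype
  -- clearing denominators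
  choose Ny hNy hNy_mem using fun i =>
    Literature.NumberTheory.Transcendental.exists_nsmul_mem_span_int x (hy_V i)
  choose Nz hNz hNz_mem using fun j =>
    Literature.NumberTheory.Transcendental.exists_nsmul_mem_span_int x (hz_V j)
  let cy : Fin k → ℚˣ := fun i => Units.mk0 (Ny i : ℚ) (Nat.cast_ne_zero.mpr (hNy i))
  let cz : Fin m → ℚˣ := fun j => Units.mk0 (Nz j : ℚ) (Nat.cast_ne_zero.mpr (hNz j))
  let y' : Fin k → ℂ := fun i => (Ny i : ℚ) • y i
  let z' : Fin m → ℂ := fun j => (Nz j : ℚ) • z j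
  have hy'_eq : cy • y = y' := by
    funext i; simp only [Pi.smul_apply', cy, y', Units.smul_def, Units.val_mk0]
  have hz'_eq : cz • z = z' := by
    funext j; simp only [Pi.smul_apply', cz, z', Units.smul_def, Units.val_mk0]
  have hy'_li : LinearIndependent ℚ y' := hy'_eq ▸ hy_li.units_smul cy
  have hz'_li : LinearIndependent ℚ z' := hz'_eq ▸ hz_li.units_smul cz
  have hy'_mem : ∀ i, y' i ∈ Eq := fun i => Eq.smul_mem _ (hy_mem i)
  have hz'_U : ∀ j, z' j ∈ U := fun j => U.smul_mem _ (hz_U j)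
  have hz'_L : ∀ j, z' j ∈ L := fun j => hVL _ (inf_le_left (b := U') (hz'_U j))
  have hz'_modE : LinearIndependent ℚ ((span ℚ S).mkQ ∘ z') := by
    refine hz'_li.map ?_
    rw [ker_mkQ]
    exact hUE_disj.mono_left (span_le.mpr (Set.range_subset_iff.mpr hz'_U))
  -- the field-theoretic estimate
  set Sy := Set.range y' ∪ Set.range (Complex.exp ∘ y') with hSy
  set Tz := Set.range (Complex.exp ∘ z') with hTz
  set Ky := adjoin ℚ Sy with hKy
  set K' := adjoin ℚ (Sy ∪ Set.range z') with hK'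
  have hk : (k : Cardinal) ≤ Algebra.trdeg ℚ Ky := hIn k y' hy'_mem hy'_li
  have hKyK' : Ky ≤ K' := adjoin.mono ℚ _ _ Set.subset_union_left
  have hk' : (k : Cardinal) ≤ Algebra.trdeg ℚ K' :=
    hk.trans (Literature.Barriers.Schanuel.trdeg_mono hKyK')
  have hK'L : K' ≤ L := by
    rw [hK', adjoin_le_iff]
    rintro a ((⟨i, rfl⟩ | ⟨i, rfl⟩) | ⟨j, rfl⟩)
    · exact mem_of_mem_span (L := L) hSL (hy'_mem i)
    · exact hexpS _ (hy'_mem i)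
    · exact hz'_L j
  have halg : AlgebraicIndependent (↥L) (fun j => Complex.exp (z' j)) := hOut m z' hz'_L hz'_modE
  have halg' : AlgebraicIndependent (↥K') (fun j => Complex.exp (z' j)) :=
    Literature.NumberTheory.Transcendental.AlgebraicIndependent.of_intermediateField_le hK'L halg
  have hm : (m : Cardinal) ≤ Algebra.trdeg (↥K') ↥(adjoin (↥K') Tz) := by
    let f : Fin m → ↥(adjoin (↥K') Tz) :=
      fun j => ⟨Complex.exp (z' j), subset_adjoin (↥K') Tz ⟨j, rfl⟩⟩
    have hf : AlgebraicIndependent (↥K') f :=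
      AlgebraicIndependent.of_comp (adjoin (↥K') Tz).val halg'
    simpa using hf.cardinalMk_le_trdeg
  have hkm : (k : Cardinal) + m ≤ Algebra.trdeg ℚ (adjoin ℚ ((Sy ∪ Set.range z') ∪ Tz)) :=
    Literature.NumberTheory.Transcendental.add_le_trdeg_adjoin_union _ Tz hk' hm
  -- comparison with `ℚ(x̄, e^{x̄})`
  set Kx := adjoin ℚ (Set.range x ∪ Set.range (Complex.exp ∘ x)) with hKx
  have hle : adjoin ℚ ((Sy ∪ Set.range z') ∪ Tz) ≤ Kx := by
    rw [adjoin_le_iff]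
    rintro a (((⟨i, rfl⟩ | ⟨i, rfl⟩) | ⟨j, rfl⟩) | ⟨j, rfl⟩)
    · exact (Literature.NumberTheory.Transcendental.mem_adjoin_of_mem_span_int x (hNy_mem i)).1
    · exact (Literature.NumberTheory.Transcendental.mem_adjoin_of_mem_span_int x (hNy_mem i)).2
    · exact (Literature.NumberTheory.Transcendental.mem_adjoin_of_mem_span_int x (hNz_mem j)).1
    · exact (Literature.NumberTheory.Transcendental.mem_adjoin_of_mem_span_int x (hNz_mem j)).2
  have hfin : Algebra.trdeg ℚ (adjoin ℚ ((Sy ∪ Set.range z') ∪ Tz)) ≤ Algebra.trdeg ℚ Kx :=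
    Literature.Barriers.Schanuel.trdeg_mono hle
  calc (n : Cardinal) = (k : Cardinal) + m := by rw [← hn, Nat.cast_add]
    _ ≤ Algebra.trdeg ℚ (adjoin ℚ ((Sy ∪ Set.range z') ∪ Tz)) := hkm
    _ ≤ Algebra.trdeg ℚ Kx := hfin

/-! ## Glue, part 3: the induction up the tower and the crux -/

/-- `e^{a} ∈ L₀` for `a ∈ ℚ·2πi`. -/
theorem exp_mem_tower_zero_of_mem_span_τ {a : ℂ} (ha : a ∈ Submodule.span ℚ ({τ} : Set ℂ)) :
    Complex.exp a ∈ tower 0 :=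
  mem_relAlgClosure_of_isAlgebraic _ (isAlgebraic_exp_of_mem_span_τ ha)

/-- **Tower reduction, level by level**: `RelLW₀` and `RelLW_{m+1}` (all `m`) give Schanuel's
statement on every level `L_m` — induction on `m` through `sectorSplit`, the base split being at
the kernel line `ℚ·2πi` (`insideKernelLine`). -/
theorem schanuelOn_tower
    (h0 : ∀ (r : ℕ) (u : Fin r → ℂ), (∀ i, u i ∈ tower 0) →
      LinearIndependent ℚ ((Submodule.span ℚ ({τ} : Set ℂ)).mkQ ∘ u) →
        AlgebraicIndependent (↥(tower 0)) (fun i => Complex.exp (u i)))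
    (hS : ∀ (m r : ℕ) (u : Fin r → ℂ), (∀ i, u i ∈ tower (m + 1)) →
      LinearIndependent ℚ ((Submodule.span ℚ (tower m : Set ℂ)).mkQ ∘ u) →
        AlgebraicIndependent (↥(tower (m + 1))) (fun i => Complex.exp (u i))) :
    ∀ (m n : ℕ) (x : Fin n → ℂ), (∀ i, x i ∈ tower m) → LinearIndependent ℚ x →
      (n : Cardinal) ≤ Algebra.trdeg ℚ ↥(adjoin ℚ (Set.range x ∪ Set.range (Complex.exp ∘ x)))
  | 0 =>
    sectorSplit {τ} (tower 0) (Set.singleton_subset_iff.mpr τ_mem_tower_zero)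
      (fun _ ha => exp_mem_tower_zero_of_mem_span_τ ha) insideKernelLine h0
  | m + 1 =>
    sectorSplit (tower m : Set ℂ) (tower (m + 1)) (tower_le_succ m)
      (fun _ ha => exp_mem_tower_succ (mem_of_mem_span (L := tower m) subset_rfl ha))
      (fun k y hy hli => schanuelOn_tower h0 hS m k y
        (fun i => mem_of_mem_span (L := tower m) subset_rfl (hy i)) hli)
      (hS m)

/-- **Tower reduction**: with the exhaustion `C_EA ⊆ ⋃ₘ L_m`, a tuple from the core sits in one
level `L_M` (the tower is monotone), where `schanuelOn_tower` applies. -/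
theorem towerReduction
    (h0 : ∀ (r : ℕ) (u : Fin r → ℂ), (∀ i, u i ∈ tower 0) →
      LinearIndependent ℚ ((Submodule.span ℚ ({τ} : Set ℂ)).mkQ ∘ u) →
        AlgebraicIndependent (↥(tower 0)) (fun i => Complex.exp (u i)))
    (hS : ∀ (m r : ℕ) (u : Fin r → ℂ), (∀ i, u i ∈ tower (m + 1)) →
      LinearIndependent ℚ ((Submodule.span ℚ (tower m : Set ℂ)).mkQ ∘ u) →
        AlgebraicIndependent (↥(tower (m + 1))) (fun i => Complex.exp (u i)))
    (hE : ∀ a : ℂ, a ∈ logFreeCore → ∃ m : ℕ, a ∈ tower m) :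
    ∀ (n : ℕ) (x : Fin n → ℂ), (∀ i, x i ∈ logFreeCore) → LinearIndependent ℚ x →
      (n : Cardinal) ≤ Algebra.trdeg ℚ ↥(adjoin ℚ (Set.range x ∪ Set.range (Complex.exp ∘ x))) := by
  intro n x hx hli
  choose lvl hlvl using fun i => hE (x i) (hx i)
  exact schanuelOn_tower h0 hS (Finset.univ.sup lvl) n x
    (fun i => tower_mono (Finset.le_sup (Finset.mem_univ i)) (hlvl i)) hli

/-- **The crux from the line** (kernel-checked composition; `sorry` only inside the stubs it is
fed): `RelLW₀`, `RelLW_{m+1}` and the exhaustion of `C_EA` by the kernel tower give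
`RigidCore.SchanuelOnLogFreeCore` BY NAME. -/
theorem SchanuelOnLogFreeCore_of :
    Summit.Schanuel.Schanuel.Theses.RigidCore.SchanuelOnLogFreeCore :=
  towerReduction stub_relLWZero stub_relLWStep stub_coreExhaustion

/-! ## The honest residue: `stub_relLWZero` at `r = 1`, `u = (1)` is `e ⊥ π`

Mechanical certificate for the census (triage cross-note 1, r1-2 sharpening): the instance
`r = 1, u = (1)` of Stub 1 already yields the open `ExpOnePiAlgebraicIndependent`
(cdisprove: `expOnePiAlgebraicIndependent_of_crux`). Sorry-free, HYPOTHETICAL in `RelLW₀`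
(it is not fed the stub, so it closes nothing and claims nothing). -/

/-- `(1)` is `ℚ`-linearly independent modulo the kernel line `ℚ·2πi` (`1 = c·2πi` would make
`2πi = c⁻¹` rational). -/
theorem linearIndependent_mkQ_one :
    LinearIndependent ℚ ((Submodule.span ℚ ({τ} : Set ℂ)).mkQ ∘ fun _ : Fin 1 => (1 : ℂ)) := by
  rw [linearIndependent_unique_iff]
  simp only [Function.comp_apply, ne_eq, Submodule.mkQ_apply, Submodule.Quotient.mk_eq_zero]
  intro h
  obtain ⟨c, hc⟩ := Submodule.mem_span_singleton.mp h
  have hc0 : c ≠ 0 := by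
    rintro rfl
    simp at hc
  apply transcendental_τ
  rw [Rat.smul_def] at hc
  have hτ : τ = ((c : ℚ) : ℂ)⁻¹ := eq_inv_of_mul_eq_one_right hc
  rw [hτ]
  exact (isAlgebraic_algebraMap (c : ℚ)).inv

/-- `π ∈ L₀` (`π = 2πi · (2i)⁻¹`, `i` algebraic). -/
theorem pi_mem_tower_zero : (Real.pi : ℂ) ∈ tower 0 := by
  have hI : Complex.I ∈ tower 0 := by
    refine mem_relAlgClosure_of_isAlgebraic _ ⟨Polynomial.X ^ 2 + 1, ?_, by simp⟩
    exact Polynomial.Monic.ne_zero (by monicity!)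
  have h2I : (2 * Complex.I : ℂ) ∈ tower 0 :=
    mul_mem (by exact_mod_cast IntermediateField.natCast_mem (tower 0) 2) hI
  have h2I0 : (2 * Complex.I : ℂ) ≠ 0 := mul_ne_zero two_ne_zero Complex.I_ne_zero
  have e : (Real.pi : ℂ) = τ * (2 * Complex.I)⁻¹ := by
    rw [eq_mul_inv_iff_mul_eq₀ h2I0]
    show (Real.pi : ℂ) * (2 * Complex.I) = 2 * (Real.pi : ℂ) * Complex.I
    ring
  rw [e]
  exact mul_mem τ_mem_tower_zero (inv_mem h2I)

/-- **Stub 1 contains `e ⊥ π`.** Under `RelLW₀`, `e = e^1` is transcendental over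
`L₀ ∋ π`, so `trdeg ℚ(π, e) = 2` by the tower law, i.e. `e` and `π` are algebraically independent
(the tree's registered open statement `ExpOnePiAlgebraicIndependent`, periods.S15). -/
theorem expOnePi_of_relLWZero
    (h0 : ∀ (r : ℕ) (u : Fin r → ℂ), (∀ i, u i ∈ tower 0) →
      LinearIndependent ℚ ((Submodule.span ℚ ({τ} : Set ℂ)).mkQ ∘ u) →
        AlgebraicIndependent (↥(tower 0)) (fun i => Complex.exp (u i))) :
    Literature.NumberTheory.Transcendental.ExpOnePiAlgebraicIndependent := by
  -- `e` transcendental over `L₀`, hence algebraically independent over `F = ℚ(π) ≤ L₀`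
  have hE : AlgebraicIndependent (↥(tower 0)) (fun _ : Fin 1 => Complex.exp 1) :=
    h0 1 (fun _ => 1) (fun _ => one_mem _) linearIndependent_mkQ_one
  set F : IntermediateField ℚ ℂ := adjoin ℚ {(Real.pi : ℂ)} with hF
  have hFL : F ≤ tower 0 := adjoin_le_iff.mpr (Set.singleton_subset_iff.mpr pi_mem_tower_zero)
  have hE' : AlgebraicIndependent (↥F) (fun _ : Fin 1 => Complex.exp 1) :=
    Literature.NumberTheory.Transcendental.AlgebraicIndependent.of_intermediateField_le hFL hE
  set T : Set ℂ := Set.range (fun _ : Fin 1 => Complex.exp 1) with hT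
  have hb : (1 : Cardinal) ≤ Algebra.trdeg (↥F) ↥(adjoin (↥F) T) := by
    let f : Fin 1 → ↥(adjoin (↥F) T) := fun j => ⟨Complex.exp 1, subset_adjoin (↥F) T ⟨j, rfl⟩⟩
    have hf : AlgebraicIndependent (↥F) f := AlgebraicIndependent.of_comp (adjoin (↥F) T).val hE'
    simpa using hf.cardinalMk_le_trdeg
  -- `π` transcendental, so `trdeg ℚ(π) ≥ 1`
  have hπ : Transcendental ℚ (Real.pi : ℂ) := fun h =>
    Literature.NumberTheory.Transcendental.transcendental_pi_holds
      ((isAlgebraic_algebraMap_iff (A := ℂ) Complex.ofReal_injective).mp h)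
  have ha : (1 : Cardinal) ≤ Algebra.trdeg ℚ ↥F :=
    one_le_trdeg_of_transcendental_mem (mem_adjoin_simple_self ℚ _) hπ
  have h2 : (1 : Cardinal) + 1 ≤ Algebra.trdeg ℚ ↥(adjoin ℚ ({(Real.pi : ℂ)} ∪ T)) :=
    Literature.NumberTheory.Transcendental.add_le_trdeg_adjoin_union _ T ha hb
  -- compare with `ℚ(e, π)` generated by the pair
  set l : Fin 2 → ℂ := ![Complex.exp 1, (Real.pi : ℂ)] with hl
  have hle : adjoin ℚ ({(Real.pi : ℂ)} ∪ T) ≤ adjoin ℚ (Set.range l) := by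
    rw [adjoin_le_iff]
    rintro a (ha | ⟨j, rfl⟩)
    · rw [Set.mem_singleton_iff.mp ha]
      exact subset_adjoin ℚ _ ⟨1, by simp [hl]⟩
    · exact subset_adjoin ℚ _ ⟨0, by simp [hl]⟩
  have h2' : ((2 : ℕ) : Cardinal) ≤ Algebra.trdeg ℚ ↥(adjoin ℚ (Set.range l)) := by
    have : ((2 : ℕ) : Cardinal) = (1 : Cardinal) + 1 := by norm_num
    rw [this]
    exact h2.trans (Literature.Barriers.Schanuel.trdeg_mono hle)
  have hC : AlgebraicIndependent ℚ l :=
    Literature.Barriers.Schanuel.algebraicIndependent_of_le_trdeg_adjoin l h2'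
  -- back to `ℝ` along `ofReal`
  refine AlgebraicIndependent.of_comp (Complex.ofRealAm.restrictScalars ℚ) ?_
  have hfun : ⇑(Complex.ofRealAm.restrictScalars ℚ) ∘ ![Real.exp 1, Real.pi] = l := by
    funext i
    fin_cases i <;> simp [hl, Complex.ofReal_exp]
  rw [hfun]
  exact hC

/-! ## Level-0 calibration: Diaz's Theorem 2.7 on the kernel grid (not on the path to `_of`) -/

/-- The powers of `2πi` are `ℚ`-linearly independent. -/
theorem linearIndependent_τpow (d : ℕ) : LinearIndependent ℚ (τpow d) := by
  rw [Fintype.linearIndependent_iff]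
  intro g hg l
  set p : Polynomial ℚ := ∑ i : Fin d, Polynomial.monomial (i : ℕ) (g i) with hp
  have hpt : Polynomial.aeval τ p = 0 := by
    simp only [hp, map_sum, Polynomial.aeval_monomial, ← Algebra.smul_def]
    exact hg
  have hp0 : p = 0 := by
    by_contra hne
    exact transcendental_τ ⟨p, hne, hpt⟩
  have hcoeff : p.coeff (l : ℕ) = g l := by
    simp only [hp, Polynomial.finsetSum_coeff, Polynomial.coeff_monomial]
    rw [Finset.sum_eq_single l]
    · simp
    · intro b _ hb
      rw [if_neg]
      exact fun h => hb (Fin.ext h)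
    · intro h; exact absurd (Finset.mem_univ l) h
  rw [← hcoeff, hp0, Polynomial.coeff_zero]

/-- **Hankel bound** (Diaz's Theorem 2.7, clause `t₂`, on the symmetric kernel grid
`x = y = (1, τ, …, τ^{d-1})`): under (T.H.) for the powers of `2πi`,
`⌈d²/2d⌉ = ⌈d/2⌉ ≤ trdeg_ℚ ℚ(τ^i, e^{τ^{i+j}}) = trdeg ℚ(π, e, e^{τ²}, …, e^{τ^{2d-2}})` for `d ≥ 3`
(`RelLW₀` predicts `2d - 1`; for `d = 3, 4` the value `2` is already Theorem 2.9 without (T.H.),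
the first new value is `3` at `d = 5`). -/
theorem hankelBound (hTH : ∀ d : ℕ, Literature.Barriers.Schanuel.TechnicalHypothesis (τpow d))
    {d : ℕ} (hd : 3 ≤ d) :
    ((⌈((d * d : ℕ) : ℚ) / ((d + d : ℕ) : ℚ)⌉₊ : ℕ) : Cardinal) ≤
      Algebra.trdeg ℚ ↥(Literature.Barriers.Schanuel.gridField₂ (τpow d) (τpow d)) :=
  Literature.Barriers.Schanuel.ceil_le_trdeg_gridField₂ (τpow d) (τpow d)
    (linearIndependent_τpow d) (hTH d) (linearIndependent_τpow d) (hTH d) (by nlinarith)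

/-- **Hankel quarter** — the line's level-0 calibration theorem, sorry-free modulo
`stub_piPowersTH`. -/
theorem hankelQuarter {d : ℕ} (hd : 3 ≤ d) :
    ((⌈((d * d : ℕ) : ℚ) / ((d + d : ℕ) : ℚ)⌉₊ : ℕ) : Cardinal) ≤
      Algebra.trdeg ℚ ↥(Literature.Barriers.Schanuel.gridField₂ (τpow d) (τpow d)) :=
  hankelBound stub_piPowersTH hd

end Summit.Schanuel.Schanuel.Cruxes.SchanuelOnLogFreeCore.KernelTowerRelativeLw

end
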